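import Literature.Analysis.FluidPDE.ConvexIntegration2DCalculus
import HarnessLib

/-!
# Convex integration in 2-D: the linear system and its third-order potential

Topic `Analysis/FluidPDE`. Support file for the proof of `ConvexIntegrationLemma2DBall`
(Chiodaroli–De Lellis–Kreml 2015, Lemma 3.7 on a ball): the algebraic half of CDK 2015,
Prop. 4.1 (localized plane waves) in explicit two-dimensional form.

* `SolvesLinear w`: the perturbation `w = (v̲₁, v̲₂, u̲₁₁, u̲₁₂)` (stress
  `u̲ = [[u̲₁₁, u̲₁₂], [u̲₁₂, -u̲₁₁]]`, symmetric and trace-free) solves `div_x v̲ = 0`,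
  `∂_t v̲ + div_x u̲ = 0` classically; closed under sums and scalar multiples; the weak
  (distributional) forms `SolvesLinear.weak_div/weak_mom₁/weak_mom₂` for compactly supported
  smooth solutions (integration by parts).
* `pot g = (-∂₂Δg, ∂₁Δg, ∂_t(2∂₁∂₂ g), ∂_t(∂₂² - ∂₁²) g)`: a third-order constant-coefficient
  potential; `solvesLinear_pot` (exactness for every smooth `g`, by Schwarz), support and mean-zero
  properties. Its symbol at `(τ, ξ)` is `(|ξ|²ξ^⊥, -τ(ξ ⊗ ξ^⊥ + ξ^⊥ ⊗ ξ))`: every direction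
  `D(n, μ) = (n, μ(e ⊗ n + n ⊗ e))`, `|n| = 1`, `e = (n₂, -n₁)`, is attained at `ξ = e`, `τ = -μ`.
  This is the two-dimensional analogue of the potential `A(∂)` of De Lellis–Székelyhidi quoted in
  CDK 2015, proof of Prop. 4.1; in two space dimensions it needs no restriction `a ≠ ±b`.

## References

* E. Chiodaroli, C. De Lellis, O. Kreml, *Global ill-posedness of the isentropic system of gas
  dynamics*, Comm. Pure Appl. Math. 68 (2015) 1157–1190, Prop. 4.1 and its proof (§4.2).
* C. De Lellis, L. Székelyhidi Jr., *On admissibility criteria for weak solutions of the Euler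
  equations*, Arch. Ration. Mech. Anal. 195 (2010) 225–260 (the potential `A(∂)`).
-/

noncomputable section

open MeasureTheory Set Metric Filter Function
open scoped ContDiff Topology

namespace Literature.Analysis.FluidPDE.ConvexIntegration


/-! ### The linear system and its third-order potential -/

/-- A perturbation `w = (v̲₁, v̲₂, u̲₁₁, u̲₁₂)` (four scalar fields on space–time; the stress is
`u̲ = [[u̲₁₁, u̲₁₂], [u̲₁₂, -u̲₁₁]]`, symmetric and trace-free) *solves the linear system
classically*: `div_x v̲ = 0` and `∂_t v̲ + div_x u̲ = 0` pointwise.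
[cite: ChiodaroliDeLellisKreml2015, Lemma 3.7 (ii)] -/
structure SolvesLinear (w : Fin 4 → ST → ℝ) : Prop where
  /-- `∂₁ v̲₁ + ∂₂ v̲₂ = 0`. -/
  div : ∀ z, pd (dX 0) (w 0) z + pd (dX 1) (w 1) z = 0
  /-- `∂_t v̲₁ + ∂₁ u̲₁₁ + ∂₂ u̲₁₂ = 0`. -/
  mom₁ : ∀ z, pd dT (w 0) z + pd (dX 0) (w 2) z + pd (dX 1) (w 3) z = 0
  /-- `∂_t v̲₂ + ∂₁ u̲₁₂ - ∂₂ u̲₁₁ = 0`. -/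
  mom₂ : ∀ z, pd dT (w 1) z + pd (dX 0) (w 3) z - pd (dX 1) (w 2) z = 0

/-- The zero perturbation solves the linear system. [folklore] -/
theorem SolvesLinear.zero : SolvesLinear (fun _ _ => 0) := by
  refine ⟨fun z => ?_, fun z => ?_, fun z => ?_⟩ <;> simp [pd_const]

/-- Sums of classical solutions are classical solutions. [folklore] -/
theorem SolvesLinear.add {w w' : Fin 4 → ST → ℝ} (hw : SolvesLinear w) (hw' : SolvesLinear w')
    (hd : ∀ i, Differentiable ℝ (w i)) (hd' : ∀ i, Differentiable ℝ (w' i)) :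
    SolvesLinear (fun i z => w i z + w' i z) := by
  refine ⟨fun z => ?_, fun z => ?_, fun z => ?_⟩
  · have h1 := hw.div z; have h2 := hw'.div z
    simp only [pd_add (hd _) (hd' _)]
    linarith
  · have h1 := hw.mom₁ z; have h2 := hw'.mom₁ z
    simp only [pd_add (hd _) (hd' _)]
    linarith
  · have h1 := hw.mom₂ z; have h2 := hw'.mom₂ z
    simp only [pd_add (hd _) (hd' _)]
    linarith

/-- Scalar multiples of classical solutions are classical solutions. [folklore] -/
theorem SolvesLinear.const_mul {w : Fin 4 → ST → ℝ} (hw : SolvesLinear w)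
    (hd : ∀ i, Differentiable ℝ (w i)) (s : ℝ) :
    SolvesLinear (fun i z => s * w i z) := by
  refine ⟨fun z => ?_, fun z => ?_, fun z => ?_⟩
  · have h1 := hw.div z
    simp only [pd_const_mul (hd _)]
    linear_combination s * h1
  · have h1 := hw.mom₁ z
    simp only [pd_const_mul (hd _)]
    linear_combination s * h1
  · have h1 := hw.mom₂ z
    simp only [pd_const_mul (hd _)]
    linear_combination s * h1

/-- Finite sums of classical solutions are classical solutions. [folklore] -/
theorem SolvesLinear.finset_sum {ι : Type*} (s : Finset ι) {w : ι → Fin 4 → ST → ℝ}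
    (hw : ∀ j ∈ s, SolvesLinear (w j)) (hd : ∀ j ∈ s, ∀ i, Differentiable ℝ (w j i)) :
    SolvesLinear (fun i z => ∑ j ∈ s, w j i z) := by
  refine ⟨fun z => ?_, fun z => ?_, fun z => ?_⟩
  · simp only [pd_finset_sum s (fun j hj => hd j hj _)]
    rw [← Finset.sum_add_distrib]
    exact Finset.sum_eq_zero fun j hj => (hw j hj).div z
  · simp only [pd_finset_sum s (fun j hj => hd j hj _)]
    rw [← Finset.sum_add_distrib, ← Finset.sum_add_distrib]
    exact Finset.sum_eq_zero fun j hj => (hw j hj).mom₁ z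
  · simp only [pd_finset_sum s (fun j hj => hd j hj _)]
    rw [← Finset.sum_add_distrib, ← Finset.sum_sub_distrib]
    exact Finset.sum_eq_zero fun j hj => (hw j hj).mom₂ z

/-- The spatial Laplacian `Δ_x g = ∂₁∂₁ g + ∂₂∂₂ g`. [folklore] -/
def lap (g : ST → ℝ) : ST → ℝ := fun z => pd (dX 0) (pd (dX 0) g) z + pd (dX 1) (pd (dX 1) g) z

/-- The auxiliary second-order fields `h₁ = 2∂₁∂₂ g`, `h₂ = (∂₂∂₂ - ∂₁∂₁) g`. [folklore] -/
def auxH (g : ST → ℝ) : Fin 2 → ST → ℝ :=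
  ![fun z => 2 * pd (dX 0) (pd (dX 1) g) z,
    fun z => pd (dX 1) (pd (dX 1) g) z - pd (dX 0) (pd (dX 0) g) z]

/-- **The third-order potential of the 2-D linear system.** For a scalar potential `g`,
`pot g = (-∂₂Δg, ∂₁Δg, ∂_t(2∂₁∂₂g), ∂_t(∂₂² - ∂₁²)g)`, i.e. `v̲ = ∇^⊥Δg`,
`u̲₁₁ = 2∂_t∂₁∂₂ g`, `u̲₁₂ = ∂_t(∂₂² - ∂₁²) g`. Every such field solves `div_x v̲ = 0`,
`∂_t v̲ + div_x u̲ = 0` (`solvesLinear_pot`); its symbol at `(τ, ξ)` is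
`(|ξ|² ξ^⊥, -τ(ξ ⊗ ξ^⊥ + ξ^⊥ ⊗ ξ))`. This is the two-dimensional analogue of the potential
`A(∂)` of De Lellis–Székelyhidi used in CDK 2015, proof of Prop. 4.1. [folklore] -/
def pot (g : ST → ℝ) : Fin 4 → ST → ℝ :=
  ![fun z => -pd (dX 1) (lap g) z, pd (dX 0) (lap g), pd dT (auxH g 0), pd dT (auxH g 1)]

section PotSmooth

variable {g : ST → ℝ}

/-- The Laplacian of a smooth function is smooth. [folklore] -/
theorem contDiff_lap (hg : ContDiff ℝ ∞ g) : ContDiff ℝ ∞ (lap g) :=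
  (contDiff_pd (contDiff_pd hg _) _).add (contDiff_pd (contDiff_pd hg _) _)

/-- The auxiliary fields of a smooth potential are smooth. [folklore] -/
theorem contDiff_auxH (hg : ContDiff ℝ ∞ g) (i : Fin 2) : ContDiff ℝ ∞ (auxH g i) := by
  fin_cases i
  · exact contDiff_const.mul (contDiff_pd (contDiff_pd hg _) _)
  · exact (contDiff_pd (contDiff_pd hg _) _).sub (contDiff_pd (contDiff_pd hg _) _)

/-- The potential fields of a smooth potential are smooth. [folklore] -/
theorem contDiff_pot (hg : ContDiff ℝ ∞ g) (i : Fin 4) : ContDiff ℝ ∞ (pot g i) := by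
  fin_cases i
  · exact (contDiff_pd (contDiff_lap hg) _).neg
  · exact contDiff_pd (contDiff_lap hg) _
  · exact contDiff_pd (contDiff_auxH hg 0) _
  · exact contDiff_pd (contDiff_auxH hg 1) _

/-- The Laplacian is supported in the support of the potential. [folklore] -/
theorem tsupport_lap_subset (g : ST → ℝ) : tsupport (lap g) ⊆ tsupport g := by
  refine (tsupport_add _ _).trans (union_subset ?_ ?_) <;>
    exact (tsupport_pd_subset _ _).trans (tsupport_pd_subset _ _)

/-- The auxiliary fields are supported in the support of the potential. [folklore] -/
theorem tsupport_auxH_subset (g : ST → ℝ) (i : Fin 2) : tsupport (auxH g i) ⊆ tsupport g := by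
  fin_cases i
  · simp only [auxH, Fin.zero_eta, Matrix.cons_val_zero]
    refine (tsupport_mul_subset_right).trans ?_
    exact (tsupport_pd_subset _ _).trans (tsupport_pd_subset _ _)
  · simp only [auxH, Fin.mk_one, Matrix.cons_val_one, Matrix.cons_val_zero]
    refine (tsupport_sub _ _).trans (union_subset ?_ ?_) <;>
      exact (tsupport_pd_subset _ _).trans (tsupport_pd_subset _ _)

/-- The potential fields are supported in the support of the potential. [folklore] -/
theorem tsupport_pot_subset (g : ST → ℝ) (i : Fin 4) : tsupport (pot g i) ⊆ tsupport g := by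
  fin_cases i
  · simp only [pot, Fin.zero_eta, Matrix.cons_val_zero]
    rw [show (fun z => -pd (dX 1) (lap g) z) = -(pd (dX 1) (lap g)) from rfl, tsupport_neg]
    exact (tsupport_pd_subset _ _).trans (tsupport_lap_subset g)
  · exact (tsupport_pd_subset _ _).trans (tsupport_lap_subset g)
  · exact (tsupport_pd_subset _ _).trans (tsupport_auxH_subset g 0)
  · exact (tsupport_pd_subset _ _).trans (tsupport_auxH_subset g 1)

/-- The potential fields of a compactly supported potential are compactly supported.
[folklore] -/
theorem hasCompactSupport_pot (hg : HasCompactSupport g) (i : Fin 4) :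
    HasCompactSupport (pot g i) :=
  hg.of_isClosed_subset (isClosed_tsupport _) (tsupport_pot_subset g i)

/-- Unfolding of `lap`. [folklore] -/
theorem lap_def (g : ST → ℝ) :
    lap g = fun z => pd (dX 0) (pd (dX 0) g) z + pd (dX 1) (pd (dX 1) g) z := rfl

/-- Unfolding of `auxH g 0`. [folklore] -/
theorem auxH_zero (g : ST → ℝ) : auxH g 0 = fun z => 2 * pd (dX 0) (pd (dX 1) g) z := rfl

/-- Unfolding of `auxH g 1`. [folklore] -/
theorem auxH_one (g : ST → ℝ) :
    auxH g 1 = fun z => pd (dX 1) (pd (dX 1) g) z - pd (dX 0) (pd (dX 0) g) z := rfl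

/-- Unfolding of `pot g 0`. [folklore] -/
theorem pot_zero (g : ST → ℝ) : pot g 0 = fun z => -pd (dX 1) (lap g) z := rfl

/-- Unfolding of `pot g 1`. [folklore] -/
theorem pot_one (g : ST → ℝ) : pot g 1 = pd (dX 0) (lap g) := rfl

/-- Unfolding of `pot g 2`. [folklore] -/
theorem pot_two (g : ST → ℝ) : pot g 2 = pd dT (auxH g 0) := rfl

/-- Unfolding of `pot g 3`. [folklore] -/
theorem pot_three (g : ST → ℝ) : pot g 3 = pd dT (auxH g 1) := rfl

/-- If `f₁ + f₂ + f₃ ≡ 0` then `∂_e f₁ + ∂_e f₂ + ∂_e f₃ ≡ 0`. [folklore] -/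
theorem pd_add_add_eq_zero {f₁ f₂ f₃ : ST → ℝ} (h₁ : Differentiable ℝ f₁)
    (h₂ : Differentiable ℝ f₂) (h₃ : Differentiable ℝ f₃) (h : ∀ y, f₁ y + f₂ y + f₃ y = 0)
    (e z : ST) : pd e f₁ z + pd e f₂ z + pd e f₃ z = 0 := by
  have hsum : (fun y => f₁ y + f₂ y + f₃ y) = fun _ => 0 := funext h
  have := congrFun (pd_add (h₁.add h₂) h₃ e (f := fun y => f₁ y + f₂ y)) z
  rw [hsum, pd_const, pd_add h₁ h₂] at this
  simpa using this.symm

/-- If `f₁ + f₂ - f₃ ≡ 0` then `∂_e f₁ + ∂_e f₂ - ∂_e f₃ ≡ 0`. [folklore] -/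
theorem pd_add_sub_eq_zero {f₁ f₂ f₃ : ST → ℝ} (h₁ : Differentiable ℝ f₁)
    (h₂ : Differentiable ℝ f₂) (h₃ : Differentiable ℝ f₃) (h : ∀ y, f₁ y + f₂ y - f₃ y = 0)
    (e z : ST) : pd e f₁ z + pd e f₂ z - pd e f₃ z = 0 := by
  have h' : ∀ y, f₁ y + f₂ y + (-f₃ y) = 0 := fun y => by rw [← sub_eq_add_neg]; exact h y
  have := pd_add_add_eq_zero h₁ h₂ h₃.neg h' e z (f₃ := fun y => -f₃ y)
  rw [pd_neg] at this
  simpa [sub_eq_add_neg] using this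

/-- **Exactness of the potential.** `pot g` solves `div_x v̲ = 0`, `∂_t v̲ + div_x u̲ = 0`
for every smooth `g` (Schwarz). [folklore] -/
theorem solvesLinear_pot (hg : ContDiff ℝ ∞ g) : SolvesLinear (pot g) := by
  have hL := contDiff_lap hg
  have h00 := contDiff_pd (contDiff_pd hg (dX 0)) (dX 0)
  have h11 := contDiff_pd (contDiff_pd hg (dX 1)) (dX 1)
  have h01 := contDiff_pd (contDiff_pd hg (dX 1)) (dX 0)
  have hH0 : ContDiff ℝ ∞ (auxH g 0) := contDiff_auxH hg 0
  have hH1 : ContDiff ℝ ∞ (auxH g 1) := contDiff_auxH hg 1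
  have hP0 : ContDiff ℝ ∞ (pot g 0) := contDiff_pot hg 0
  have hP1 : ContDiff ℝ ∞ (pot g 1) := contDiff_pot hg 1
  -- the two spatial identities behind the momentum equations
  have key₁ : ∀ y, pot g 0 y + pd (dX 0) (auxH g 0) y + pd (dX 1) (auxH g 1) y = 0 := by
    intro y
    rw [pot_zero, auxH_zero, auxH_one, lap_def,
      pd_add (differentiable_of_smooth h00) (differentiable_of_smooth h11),
      pd_const_mul (differentiable_of_smooth h01),
      pd_sub (differentiable_of_smooth h11) (differentiable_of_smooth h00)]
    have e1 : pd (dX 0) (pd (dX 0) (pd (dX 1) g)) = pd (dX 1) (pd (dX 0) (pd (dX 0) g)) := by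
      rw [pd_comm_smooth hg (dX 0) (dX 1), pd_comm_smooth (contDiff_pd hg (dX 0)) (dX 0) (dX 1)]
    beta_reduce
    rw [e1]
    ring
  have key₂ : ∀ y, pot g 1 y + pd (dX 0) (auxH g 1) y - pd (dX 1) (auxH g 0) y = 0 := by
    intro y
    rw [pot_one, auxH_zero, auxH_one, lap_def,
      pd_add (differentiable_of_smooth h00) (differentiable_of_smooth h11),
      pd_const_mul (differentiable_of_smooth h01),
      pd_sub (differentiable_of_smooth h11) (differentiable_of_smooth h00)]
    have e1 : pd (dX 1) (pd (dX 0) (pd (dX 1) g)) = pd (dX 0) (pd (dX 1) (pd (dX 1) g)) := by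
      rw [pd_comm_smooth (contDiff_pd hg (dX 1)) (dX 1) (dX 0)]
    beta_reduce
    rw [e1]
    ring
  refine ⟨fun z => ?_, fun z => ?_, fun z => ?_⟩
  · -- `-∂₁∂₂Δg + ∂₂∂₁Δg = 0`
    rw [pot_zero, pot_one, pd_neg]
    beta_reduce
    rw [pd_comm_smooth hL (dX 0) (dX 1)]
    ring
  · -- `∂_t [pot₀ + ∂₁h₁ + ∂₂h₂] = 0`
    rw [pot_two, pot_three, pd_comm_smooth hH0 (dX 0) dT, pd_comm_smooth hH1 (dX 1) dT]
    exact pd_add_add_eq_zero (differentiable_of_smooth hP0)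
      (differentiable_of_smooth (contDiff_pd hH0 _))
      (differentiable_of_smooth (contDiff_pd hH1 _)) key₁ dT z
  · -- `∂_t [pot₁ + ∂₁h₂ - ∂₂h₁] = 0`
    rw [pot_two, pot_three, pd_comm_smooth hH1 (dX 0) dT, pd_comm_smooth hH0 (dX 1) dT]
    exact pd_add_sub_eq_zero (differentiable_of_smooth hP1)
      (differentiable_of_smooth (contDiff_pd hH1 _))
      (differentiable_of_smooth (contDiff_pd hH0 _)) key₂ dT z

end PotSmooth


/-! ### Weak formulation of classical solutions -/

section Weak

/-- `∫ f · ∂_e g = -∫ ∂_e f · g` for `C¹` functions, `f` compactly supported. [folklore] -/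
theorem integral_mul_pd_eq_neg {f g : ST → ℝ} (hf : ContDiff ℝ 1 f) (hg : ContDiff ℝ 1 g)
    (hfc : HasCompactSupport f) (e : ST) :
    ∫ z, f z * pd e g z = - ∫ z, pd e f z * g z := by
  rw [integral_pd_mul_eq_neg hf hg hfc e, neg_neg]

variable {w : Fin 4 → ST → ℝ}

/-- Integrability of `w · h` for `w` compactly supported `C¹` and `h` continuous. [folklore] -/
theorem integrable_mul_of_cs {f h : ST → ℝ} (hf : Continuous f) (hfc : HasCompactSupport f)
    (hh : Continuous h) : Integrable (fun z => f z * h z) :=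
  (hf.mul hh).integrable_of_hasCompactSupport hfc.mul_right

/-- **Weak form of `div_x v̲ = 0`** for a compactly supported classical solution:
`∫ (v̲₁ ∂₁φ + v̲₂ ∂₂φ) = 0` for every `C¹` function `φ`. [folklore] -/
theorem SolvesLinear.weak_div (hw : SolvesLinear w) (hs : ∀ i, ContDiff ℝ ∞ (w i))
    (hc : ∀ i, HasCompactSupport (w i)) {φ : ST → ℝ} (hφ : ContDiff ℝ 1 φ) :
    ∫ z, (w 0 z * pd (dX 0) φ z + w 1 z * pd (dX 1) φ z) = 0 := by
  have h1 : ∀ i, ContDiff ℝ 1 (w i) := fun i => (hs i).of_le one_le_infty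
  rw [integral_add (integrable_mul_of_cs (h1 0).continuous (hc 0) (continuous_pd hφ _))
      (integrable_mul_of_cs (h1 1).continuous (hc 1) (continuous_pd hφ _)),
    integral_mul_pd_eq_neg (h1 0) hφ (hc 0), integral_mul_pd_eq_neg (h1 1) hφ (hc 1),
    ← neg_add, ← integral_add
      (integrable_mul_of_cs (continuous_pd (h1 0) _) (hasCompactSupport_pd (hc 0) _) hφ.continuous)
      (integrable_mul_of_cs (continuous_pd (h1 1) _) (hasCompactSupport_pd (hc 1) _) hφ.continuous)]
  have : (fun z => pd (dX 0) (w 0) z * φ z + pd (dX 1) (w 1) z * φ z) = fun _ => 0 := by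
    funext z; rw [← add_mul, hw.div z, zero_mul]
  rw [this]; simp

/-- **Weak form of the first momentum equation** for a compactly supported classical
solution: `∫ (v̲₁ ∂_tθ + u̲₁₁ ∂₁θ + u̲₁₂ ∂₂θ) = 0`. [folklore] -/
theorem SolvesLinear.weak_mom₁ (hw : SolvesLinear w) (hs : ∀ i, ContDiff ℝ ∞ (w i))
    (hc : ∀ i, HasCompactSupport (w i)) {θ : ST → ℝ} (hθ : ContDiff ℝ 1 θ) :
    ∫ z, (w 0 z * pd dT θ z + w 2 z * pd (dX 0) θ z + w 3 z * pd (dX 1) θ z) = 0 := by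
  have h1 : ∀ i, ContDiff ℝ 1 (w i) := fun i => (hs i).of_le one_le_infty
  have I : ∀ i e, Integrable (fun z => w i z * pd e θ z) := fun i e =>
    integrable_mul_of_cs (h1 i).continuous (hc i) (continuous_pd hθ _)
  have J : ∀ i e, Integrable (fun z => pd e (w i) z * θ z) := fun i e =>
    integrable_mul_of_cs (continuous_pd (h1 i) _) (hasCompactSupport_pd (hc i) _) hθ.continuous
  have I02 : Integrable (fun z => w 0 z * pd dT θ z + w 2 z * pd (dX 0) θ z) := (I 0 _).add (I 2 _)
  have J02 : Integrable (fun z => pd dT (w 0) z * θ z + pd (dX 0) (w 2) z * θ z) :=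
    (J 0 _).add (J 2 _)
  rw [integral_add I02 (I 3 _), integral_add (I 0 _) (I 2 _),
    integral_mul_pd_eq_neg (h1 0) hθ (hc 0), integral_mul_pd_eq_neg (h1 2) hθ (hc 2),
    integral_mul_pd_eq_neg (h1 3) hθ (hc 3), ← neg_add, ← neg_add,
    ← integral_add (J 0 _) (J 2 _), ← integral_add J02 (J 3 _)]
  have : (fun z => pd dT (w 0) z * θ z + pd (dX 0) (w 2) z * θ z + pd (dX 1) (w 3) z * θ z)
      = fun _ => 0 := by
    funext z; rw [← add_mul, ← add_mul, hw.mom₁ z, zero_mul]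
  rw [this]; simp

/-- **Weak form of the second momentum equation** for a compactly supported classical
solution: `∫ (v̲₂ ∂_tθ + u̲₁₂ ∂₁θ - u̲₁₁ ∂₂θ) = 0`. [folklore] -/
theorem SolvesLinear.weak_mom₂ (hw : SolvesLinear w) (hs : ∀ i, ContDiff ℝ ∞ (w i))
    (hc : ∀ i, HasCompactSupport (w i)) {θ : ST → ℝ} (hθ : ContDiff ℝ 1 θ) :
    ∫ z, (w 1 z * pd dT θ z + w 3 z * pd (dX 0) θ z - w 2 z * pd (dX 1) θ z) = 0 := by
  have h1 : ∀ i, ContDiff ℝ 1 (w i) := fun i => (hs i).of_le one_le_infty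
  have I : ∀ i e, Integrable (fun z => w i z * pd e θ z) := fun i e =>
    integrable_mul_of_cs (h1 i).continuous (hc i) (continuous_pd hθ _)
  have J : ∀ i e, Integrable (fun z => pd e (w i) z * θ z) := fun i e =>
    integrable_mul_of_cs (continuous_pd (h1 i) _) (hasCompactSupport_pd (hc i) _) hθ.continuous
  have I13 : Integrable (fun z => w 1 z * pd dT θ z + w 3 z * pd (dX 0) θ z) := (I 1 _).add (I 3 _)
  have J13 : Integrable (fun z => pd dT (w 1) z * θ z + pd (dX 0) (w 3) z * θ z) :=
    (J 1 _).add (J 3 _)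
  rw [integral_sub I13 (I 2 _), integral_add (I 1 _) (I 3 _),
    integral_mul_pd_eq_neg (h1 1) hθ (hc 1), integral_mul_pd_eq_neg (h1 3) hθ (hc 3),
    integral_mul_pd_eq_neg (h1 2) hθ (hc 2)]
  rw [show -(∫ z, pd dT (w 1) z * θ z) + -(∫ z, pd (dX 0) (w 3) z * θ z)
      - -(∫ z, pd (dX 1) (w 2) z * θ z)
      = -((∫ z, pd dT (w 1) z * θ z) + (∫ z, pd (dX 0) (w 3) z * θ z)
      - ∫ z, pd (dX 1) (w 2) z * θ z) by ring]
  rw [← integral_add (J 1 _) (J 3 _), ← integral_sub J13 (J 2 _)]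
  have : (fun z => pd dT (w 1) z * θ z + pd (dX 0) (w 3) z * θ z - pd (dX 1) (w 2) z * θ z)
      = fun _ => 0 := by
    funext z; rw [← add_mul, ← sub_mul, hw.mom₂ z, zero_mul]
  rw [this]; simp

end Weak

/-- The potential fields have vanishing integrals (they are derivatives of compactly
supported functions). [folklore] -/
theorem integral_pot_eq_zero {g : ST → ℝ} (hg : ContDiff ℝ ∞ g) (hgc : HasCompactSupport g)
    (i : Fin 4) : ∫ z, pot g i z = 0 := by
  have hL1 : ContDiff ℝ 1 (lap g) := (contDiff_lap hg).of_le one_le_infty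
  have hLc : HasCompactSupport (lap g) :=
    hgc.of_isClosed_subset (isClosed_tsupport _) (tsupport_lap_subset g)
  have hH1 : ∀ j, ContDiff ℝ 1 (auxH g j) := fun j => (contDiff_auxH hg j).of_le one_le_infty
  have hHc : ∀ j, HasCompactSupport (auxH g j) := fun j =>
    hgc.of_isClosed_subset (isClosed_tsupport _) (tsupport_auxH_subset g j)
  fin_cases i
  · simp only [pot, Fin.zero_eta, Matrix.cons_val_zero]
    rw [integral_neg, integral_pd_eq_zero hL1 hLc, neg_zero]
  · exact integral_pd_eq_zero hL1 hLc _
  · exact integral_pd_eq_zero (hH1 0) (hHc 0) _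
  · exact integral_pd_eq_zero (hH1 1) (hHc 1) _

end Literature.Analysis.FluidPDE.ConvexIntegration
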